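import Mathlib
import Summits.ValiantsHypothesis.ValiantsHypothesis.Theorems.KPlusLogSqLawLiftingFiniteBaseChordOthers

/-!
# Patchworking at finite base, chord margins (part 3): a window carries EXACTLY its tropical count — hidden slopes allowed —
when the hidden terms lie below the CHORD of the window; base polynomial in `N · D_max`

HONEST FRAMING.  Helper file toward the lifting crux `WeakLifting` (stmt-ValiantsHypothesis-19561; aside `Lifting`
stmt-ValiantsHypothesis-19772, registered stub `stub_liftThin`) of route `KPlusLogSqLaw` (cell `pub-symmetroid`, seat
val-sym-lift-p1 g9, 2026-08-27).  A DESIGN-LEVEL, single-window statement about the patchworked pencil of ONE tropical design at finite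
base; nothing here asserts `WeakLifting`, `TropicalB`, Conjecture B, `MatrixDescartes` (stmt-ValiantsHypothesis-18050) or anything about
VP ≠ VNP, and nothing is claimed about far-from-tropical pencils.

THEOREM (`card_roots_window_eq_of_chordMargin`).  Let `(d, v, ε)` be a design (`|ε| ≤ 1`), `b > 1`, `f_b = det Σ_l X^{d_l} patchMatrix b v ε l`,
`N = m!·K^m`, and let `p₁ ≠ p₂` be terms dominant with margin `M` at integer slopes `θ₁ < θ₂`; let `D_max` bound the slopes of the present
terms and assume the base condition `6 N (D_max + 1) ≤ b^M`.  Suppose every present term `q` whose slope lies STRICTLY BETWEEN `D(p₁)` and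
`D(p₂)` (a HIDDEN slope of the window) lies below the CHORD of the edge `(p₁, p₂)` by the margin `M`:
`V(p₁)(D(p₂) − D(q)) + V(p₂)(D(q) − D(p₁)) + M (D(p₂) − D(p₁)) ≤ V(q)(D(p₂) − D(p₁))`.  Then the number of distinct zeros of `f_b` in the
window `(b^{θ₁}, b^{θ₂})` is EXACTLY `1` if `termSign p₁ · termSign p₂ < 0` and `0` otherwise.
So at finite base the real excess of a window over its tropical count can only come from hidden terms CLOSE TO THE CHORD (within `M` of the
edge of the Newton polygon); compare `card_roots_window_eq_of_noHidden` (no hidden slopes at all) and lift-p2's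
`ExactPatchwork.card_posRoots_patch_eq_card_alternating` (margin `1` at integer tie slopes, base `16 N (D+1) 4^D`): here the base is
POLYNOMIAL, `(6 N (D_max+1))^{1/M}`.
PROOF.  Every other term is at most `b^{−M}(T₁ + T₂)` on the whole window (`T_i` the masses of `p_i`): terms of slope `≤ D(p₁)` / `≥ D(p₂)` by
the integer-slope margins and ratio monotonicity, hidden terms by the chord bound (part 1).  With the transition points `T₂(p) = T₁(p)/2`,
`T₂(q) = 2 T₁(q)` this verifies lift-p2's dominance and derivative-margin inequalities (D), (M) at `p` and `q` (`…LiftingNewtonWindows`):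
no zero on `(b^{θ₁}, p]` and `[q, b^{θ₂})` (convexity transport), at most one on `[p, q]` (monotonicity of `f/x^{D(p₁)}`), none unless the
edge alternates, and one if it does (intermediate values).  No `def`.  [folklore] (quantitative one-variable Viro patchworking.)
-/

set_option linter.dupNamespace false
set_option autoImplicit false

namespace Summit.ValiantsHypothesis.ValiantsHypothesis.Theorems.KPlusLogSqLaw.LocalDescartes

open Polynomial Finset
open scoped BigOperators
open Summit.ValiantsHypothesis.ValiantsHypothesis.Theorems.MatrixDescartes.Negative
  (patchMatrix tropWeight termSign abs_termSign_eq_one)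
open Summit.ValiantsHypothesis.ValiantsHypothesis.Theorems.KPlusLogSqLaw.ExactPatchwork
  (weighted_mass_le_sum_terms mul_eval_pos_of_dominant sum_mul_pow_lt_of_endpoints
    eq_of_isRoot_of_mem_window eval_ne_zero_of_mem_window_of_pos exists_root_of_alternating_window)

variable {m K : ℕ}

/-! ## Bookkeeping at a real point -/
/-! ## The exact window under a chord margin -/

set_option maxHeartbeats 1600000 in
/-- **EXACT WINDOW AT FINITE BASE UNDER A CHORD MARGIN (hidden slopes allowed).**  Let `p₁ ≠ p₂` be dominant with margin `M` at the integer
slopes `θ₁ < θ₂`, let `D_max` bound the present slopes, `6 N (D_max + 1) ≤ b^M`, and let every present term of slope strictly between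
`D(p₁)` and `D(p₂)` lie below the CHORD of `(p₁, p₂)` by `M` (`V(p₁)(D(p₂)−D(q)) + V(p₂)(D(q)−D(p₁)) + M(D(p₂)−D(p₁)) ≤ V(q)(D(p₂)−D(p₁))`).  Then
`f_b = det F_b` has EXACTLY `[termSign p₁ · termSign p₂ < 0]` distinct zeros in `(b^{θ₁}, b^{θ₂})` — hidden slopes notwithstanding.
[folklore] -/
theorem card_roots_window_eq_of_chordMargin (b : ℝ) (hb : 1 < b) (d : Fin K → ℕ) (v ε : Fin m → Fin m → Fin K → ℤ)
    (hε : ∀ i j l, (ε i j l).natAbs ≤ 1) (M Dmax : ℕ)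
    (hDmax : ∀ q : Equiv.Perm (Fin m) × (Fin m → Fin K), termSign ε q ≠ 0 → (∑ i, d (q.2 i)) ≤ Dmax)
    (hbase : 6 * (Fintype.card (Equiv.Perm (Fin m) × (Fin m → Fin K)) : ℝ) * ((Dmax : ℝ) + 1) ≤ b ^ M)
    {θ₁ θ₂ : ℤ} (hθ : θ₁ < θ₂) (p₁ p₂ : Equiv.Perm (Fin m) × (Fin m → Fin K)) (hne : p₁ ≠ p₂)
    (hp₁ : termSign ε p₁ ≠ 0) (hp₂ : termSign ε p₂ ≠ 0)
    (hmar₁ : ∀ q, q ≠ p₁ → termSign ε q ≠ 0 → tropWeight d v θ₁ q + M ≤ tropWeight d v θ₁ p₁)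
    (hmar₂ : ∀ q, q ≠ p₂ → termSign ε q ≠ 0 → tropWeight d v θ₂ q + M ≤ tropWeight d v θ₂ p₂)
    (hchord : ∀ q : Equiv.Perm (Fin m) × (Fin m → Fin K), termSign ε q ≠ 0 →
      (∑ i, d (p₁.2 i)) < (∑ i, d (q.2 i)) → (∑ i, d (q.2 i)) < (∑ i, d (p₂.2 i)) →
      (∑ i, v (p₁.1 i) i (p₁.2 i)) * (((∑ i, d (p₂.2 i) : ℕ) : ℤ) - ((∑ i, d (q.2 i) : ℕ) : ℤ))
        + (∑ i, v (p₂.1 i) i (p₂.2 i)) * (((∑ i, d (q.2 i) : ℕ) : ℤ) - ((∑ i, d (p₁.2 i) : ℕ) : ℤ))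
        + (M : ℤ) * (((∑ i, d (p₂.2 i) : ℕ) : ℤ) - ((∑ i, d (p₁.2 i) : ℕ) : ℤ))
        ≤ (∑ i, v (q.1 i) i (q.2 i)) * (((∑ i, d (p₂.2 i) : ℕ) : ℤ) - ((∑ i, d (p₁.2 i) : ℕ) : ℤ))) :
    (((∑ l, (X : ℝ[X]) ^ d l • (patchMatrix b v ε l).map C).det).roots.toFinset.filter
        (fun x => b ^ θ₁ < x ∧ x < b ^ θ₂)).card
      = if termSign ε p₁ * termSign ε p₂ < 0 then 1 else 0 := by
  classical
  have hb0 : 0 < b := lt_trans one_pos hb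
  have hb1 : 1 ≤ b := hb.le
  set f := ((∑ l, (X : ℝ[X]) ^ d l • (patchMatrix b v ε l).map C).det) with hf
  set N : ℕ := Fintype.card (Equiv.Perm (Fin m) × (Fin m → Fin K)) with hNdef
  set D₁ := ∑ i, d (p₁.2 i) with hD₁
  set D₂ := ∑ i, d (p₂.2 i) with hD₂
  set V₁ := ∑ i, v (p₁.1 i) i (p₁.2 i) with hV₁
  set V₂ := ∑ i, v (p₂.1 i) i (p₂.2 i) with hV₂
  set a := b ^ θ₁ with ha
  set c := b ^ θ₂ with hc
  set η : ℝ := (b ^ (M : ℤ))⁻¹ with hη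
  -- term masses at a real point
  set T : Equiv.Perm (Fin m) × (Fin m → Fin K) → ℝ → ℝ :=
    fun q x => b ^ (-(∑ i, v (q.1 i) i (q.2 i))) * x ^ (∑ i, d (q.2 i)) with hT
  have ha0 : 0 < a := zpow_pos hb0 _
  have hc0 : 0 < c := zpow_pos hb0 _
  have hac : a < c := zpow_lt_zpow_right₀ hb hθ
  have hN1 : (1 : ℝ) ≤ N := by exact_mod_cast Fintype.card_pos_iff.mpr ⟨p₁⟩
  have hN0 : (0 : ℝ) < N := by linarith
  ------------------------------------------------------------------ numeric facts
  have hbM : (0 : ℝ) < b ^ M := pow_pos hb0 M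
  have hηdef : η = (b ^ M)⁻¹ := by rw [hη, zpow_natCast]
  have hη0 : 0 < η := by rw [hηdef]; exact inv_pos.mpr hbM
  have hNle : (N : ℝ) ≤ b ^ M := by
    have : (Dmax : ℝ) + 1 ≥ 1 := by have := Nat.cast_nonneg (α := ℝ) Dmax; linarith
    nlinarith
  -- `M ≥ 1` (else `b^M = 1 < 6`)
  have hM1 : 1 ≤ M := by
    by_contra h0
    push Not at h0
    have : M = 0 := by omega
    rw [this, pow_zero] at hbase
    have : (Dmax : ℝ) + 1 ≥ 1 := by have := Nat.cast_nonneg (α := ℝ) Dmax; linarith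
    nlinarith
  -- `N η (Dmax + 1) ≤ 1/6`
  have hkey : (N : ℝ) * η * ((Dmax : ℝ) + 1) ≤ 1 / 6 := by
    rw [hηdef]
    have : (N : ℝ) * (b ^ M)⁻¹ * ((Dmax : ℝ) + 1) = (N * ((Dmax : ℝ) + 1)) / b ^ M := by ring
    rw [this, div_le_iff₀ hbM]
    linarith
  ------------------------------------------------------------------ slopes
  have hD12 : D₁ < D₂ := by
    have hle : D₁ ≤ D₂ := slope_le_of_margin d v ε hθ M p₁ p₂ hp₁ hp₂ hmar₁ hmar₂
    rcases Nat.eq_or_lt_of_le hle with heq | hlt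
    · exfalso
      have h1 := hmar₁ p₂ (Ne.symm hne) hp₂
      have h2 := hmar₂ p₁ hne hp₁
      unfold tropWeight at h1 h2
      have e1 : ((D₁ : ℕ) : ℤ) = ∑ i, (d (p₁.2 i) : ℤ) := by rw [hD₁]; push_cast; rfl
      have e2 : ((D₂ : ℕ) : ℤ) = ∑ i, (d (p₂.2 i) : ℤ) := by rw [hD₂]; push_cast; rfl
      have e : (∑ i, (d (p₁.2 i) : ℤ)) = ∑ i, (d (p₂.2 i) : ℤ) := by rw [← e1, ← e2, heq]
      rw [e] at h1 h2
      have hM0 : (1 : ℤ) ≤ (M : ℤ) := by exact_mod_cast hM1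
      nlinarith
    · exact hlt
  obtain ⟨n, hn⟩ : ∃ n, D₂ = D₁ + n := ⟨D₂ - D₁, by omega⟩
  have hn0 : n ≠ 0 := by omega
  have hD2le : D₂ ≤ Dmax := hDmax p₂ hp₂
  have hDmax1 : (1 : ℝ) ≤ (Dmax : ℝ) := by
    have : 1 ≤ Dmax := by omega
    exact_mod_cast this
  have hNη : (N : ℝ) * η ≤ 1 / 12 := by nlinarith
  ------------------------------------------------------------------ every other term is `≤ η (T₁ + T₂)` on `[a, c]`
  have hT2a : T p₂ a ≤ η * T p₁ a := by
    simp only [hT, ha]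
    rw [zpow_neg_mul_zpow_pow_eq b hb0 d v θ₁ p₂, zpow_neg_mul_zpow_pow_eq b hb0 d v θ₁ p₁, hη, ← zpow_neg,
      ← zpow_add₀ hb0.ne']
    exact zpow_le_zpow_right₀ hb1 (by have := hmar₁ p₂ (Ne.symm hne) hp₂; linarith)
  have hT1c : T p₁ c ≤ η * T p₂ c := by
    simp only [hT, hc]
    rw [zpow_neg_mul_zpow_pow_eq b hb0 d v θ₂ p₁, zpow_neg_mul_zpow_pow_eq b hb0 d v θ₂ p₂, hη, ← zpow_neg,
      ← zpow_add₀ hb0.ne']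
    exact zpow_le_zpow_right₀ hb1 (by have := hmar₂ p₁ hne hp₁; linarith)
  have hsum_others : ∀ {x : ℝ}, a ≤ x → x ≤ c → ∀ (φ : ℕ → ℝ) (Φ : ℝ), 0 ≤ Φ →
      (∀ q : Equiv.Perm (Fin m) × (Fin m → Fin K), termSign ε q ≠ 0 → φ (∑ i, d (q.2 i)) ≤ Φ) →
      ∑ q ∈ (Finset.univ.erase p₁).erase p₂, φ (∑ i, d (q.2 i)) * |(termSign ε q : ℝ)| * b ^ (-(∑ i, v (q.1 i) i (q.2 i)))
          * x ^ (∑ i, d (q.2 i))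
        ≤ (N : ℝ) * Φ * η * (T p₁ x + T p₂ x) := by
    intro x hax hxc φ Φ hΦ hφΦ
    have h := others_mass_le_of_chordMargin b hb d v ε hε M p₁ p₂ hmar₁ hmar₂ hchord hax hxc φ Φ hΦ hφΦ
    simp only [hT, hη, hNdef]
    exact h

  ------------------------------------------------------------------ the transition points
  obtain ⟨p, hp0, hpT⟩ := exists_transition_point (zpow_pos hb0 (-V₁)) (zpow_pos hb0 (-V₂)) (by norm_num : (0:ℝ) < 1 / 2) D₁ hn0
  obtain ⟨q, hq0, hqT⟩ := exists_transition_point (zpow_pos hb0 (-V₁)) (zpow_pos hb0 (-V₂)) (by norm_num : (0:ℝ) < 2) D₁ hn0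
  have hpT' : T p₂ p = (1 / 2) * T p₁ p := by simp only [hT, ← hD₁, ← hD₂, ← hV₁, ← hV₂, hn]; exact hpT
  have hqT' : T p₂ q = 2 * T p₁ q := by simp only [hT, ← hD₁, ← hD₂, ← hV₁, ← hV₂, hn]; exact hqT
  -- ordering `a < p < q < c`
  have hη12 : η < 1 / 2 := by nlinarith
  have hap : a < p := by
    refine lt_of_ratio_le_of_le_ratio (zpow_pos hb0 (-V₁)) (zpow_pos hb0 (-V₂)) ha0 hp0 D₁ (n := n) ?_ (le_of_eq hpT.symm) hη12
    have := hT2a; simp only [hT, ← hD₁, ← hD₂, ← hV₁, ← hV₂, hn] at this; exact this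
  have hpq : p < q := by
    refine lt_of_ratio_le_of_le_ratio (zpow_pos hb0 (-V₁)) (zpow_pos hb0 (-V₂)) hp0 hq0 D₁ (n := n) (le_of_eq hpT)
      (le_of_eq hqT.symm) (by norm_num)
  have hqc : q < c := by
    have h2η : (2 : ℝ) < η⁻¹ := by
      rw [lt_inv_comm₀ (by norm_num) hη0]; linarith
    refine lt_of_ratio_le_of_le_ratio (zpow_pos hb0 (-V₁)) (zpow_pos hb0 (-V₂)) hq0 hc0 D₁ (n := n) (le_of_eq hqT) ?_ h2η
    -- `η⁻¹ T₁(c) ≤ T₂(c)`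
    have := hT1c; simp only [hT, ← hD₁, ← hD₂, ← hV₁, ← hV₂, hn] at this
    calc η⁻¹ * (b ^ (-V₁) * c ^ D₁) ≤ η⁻¹ * (η * (b ^ (-V₂) * c ^ (D₁ + n))) :=
          mul_le_mul_of_nonneg_left this (inv_pos.mpr hη0).le
      _ = b ^ (-V₂) * c ^ (D₁ + n) := by field_simp
  have hpa : a ≤ p := hap.le
  have hpc : p ≤ c := (hpq.trans hqc).le
  have hqa : a ≤ q := (hap.trans hpq).le
  have hqc' : q ≤ c := hqc.le
  ------------------------------------------------------------------ coefficient signs and support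
  have hs₁ := termSign_mul_coeff_pos_of_margin b hb d v ε hε θ₁ M p₁ hp₁ hmar₁ (by rw [← hNdef]; exact hNle)
  have hs₂ := termSign_mul_coeff_pos_of_margin b hb d v ε hε θ₂ M p₂ hp₂ hmar₂ (by rw [← hNdef]; exact hNle)
  rw [← hf, ← hD₁] at hs₁
  rw [← hf, ← hD₂] at hs₂
  have hc₁ : f.coeff D₁ ≠ 0 := fun h => by rw [h, mul_zero] at hs₁; exact lt_irrefl _ hs₁
  have hc₂ : f.coeff D₂ ≠ 0 := fun h => by rw [h, mul_zero] at hs₂; exact lt_irrefl _ hs₂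
  have hf0 : f ≠ 0 := fun h => hc₁ (by rw [h, Polynomial.coeff_zero])
  have hsupp₂ : D₂ ∈ f.support := Polynomial.mem_support_iff.mpr hc₂
  have hiff : f.coeff D₁ * f.coeff D₂ < 0 ↔ termSign ε p₁ * termSign ε p₂ < 0 := by
    have key : 0 < ((termSign ε p₁ : ℝ) * (termSign ε p₂ : ℝ)) * (f.coeff D₁ * f.coeff D₂) := by
      have := mul_pos hs₁ hs₂; linarith [this]
    constructor
    · intro h
      have : (termSign ε p₁ : ℝ) * (termSign ε p₂ : ℝ) < 0 := by
        by_contra hge; push Not at hge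
        linarith [mul_nonpos_of_nonneg_of_nonpos hge h.le]
      exact_mod_cast this
    · intro h
      have h' : (termSign ε p₁ : ℝ) * (termSign ε p₂ : ℝ) < 0 := by exact_mod_cast h
      by_contra hge; push Not at hge
      linarith [mul_nonpos_of_nonpos_of_nonneg h'.le hge]
  ------------------------------------------------------------------ masses via the Leibniz terms at `p` and `q`
  -- the vertex lower bounds at `p` and `q`
  have hfib : ∀ {x : ℝ}, a ≤ x → x ≤ c → ∀ (P : Equiv.Perm (Fin m) × (Fin m → Fin K)), p₁ = P ∨ p₂ = P →
      ∑ q' ∈ (Finset.univ.erase P).filter (fun q' => (∑ i, d (q'.2 i)) = ∑ i, d (P.2 i)),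
          |(termSign ε q' : ℝ)| * b ^ (-(∑ i, v (q'.1 i) i (q'.2 i))) * x ^ (∑ i, d (q'.2 i))
        ≤ (N : ℝ) * η * (T p₁ x + T p₂ x) := by
    intro x hax hxc P hP
    have h := hsum_others hax hxc (fun _ => (1 : ℝ)) 1 zero_le_one (fun _ _ => le_rfl)
    simp only [one_mul, mul_one] at h
    refine le_trans (sum_le_others _ (fun q' => ?_) p₁ p₂ _ ?_ ?_) h
    · exact mul_nonneg (mul_nonneg (abs_nonneg _) (zpow_pos hb0 _).le)
        (pow_nonneg (lt_of_lt_of_le ha0 hax).le _)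
    · intro hmem
      rw [Finset.mem_filter, Finset.mem_erase] at hmem
      rcases hP with hP | hP
      · exact hmem.1.1 hP
      · rw [← hP] at hmem
        exact absurd hmem.2 (by rw [← hD₁, ← hD₂]; omega)
    · intro hmem
      rw [Finset.mem_filter, Finset.mem_erase] at hmem
      rcases hP with hP | hP
      · rw [← hP] at hmem
        exact absurd hmem.2 (by rw [← hD₁, ← hD₂]; omega)
      · exact hmem.1.1 hP
  have hvert : ∀ {x : ℝ}, a ≤ x → x ≤ c → ∀ (P : Equiv.Perm (Fin m) × (Fin m → Fin K)), p₁ = P ∨ p₂ = P →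
      T P x - (N : ℝ) * η * (T p₁ x + T p₂ x) ≤ |f.coeff (∑ i, d (P.2 i))| * x ^ (∑ i, d (P.2 i)) := by
    intro x hax hxc P hP
    have hx0 : 0 < x := lt_of_lt_of_le ha0 hax
    have hPp : termSign ε P ≠ 0 := by
      rcases hP with hP | hP
      · rw [← hP]; exact hp₁
      · rw [← hP]; exact hp₂
    have h1 := vertex_mass_sub_le_abs_coeff_mul_pow b hb0 d v ε hε P hPp hx0
    have h2 := hfib hax hxc P hP
    simp only [hT] at h2 ⊢
    rw [← hf] at h1
    linarith
  -- the competitor upper bounds at `p` and `q` (dominance form, weight 1)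
  have hcompD : ∀ {x : ℝ}, a ≤ x → x ≤ c → ∀ (P Q : Equiv.Perm (Fin m) × (Fin m → Fin K)),
      (p₁ = P ∧ p₂ = Q) ∨ (p₂ = P ∧ p₁ = Q) → termSign ε Q ≠ 0 →
      ∑ s ∈ f.support.erase (∑ i, d (P.2 i)), |f.coeff s| * x ^ s ≤ T Q x + (N : ℝ) * η * (T p₁ x + T p₂ x) := by
    intro x hax hxc P Q hPQ hQ
    have hx0 : 0 < x := lt_of_lt_of_le ha0 hax
    have hw := weighted_mass_le_sum_terms b hb0 d v ε (f.support.erase (∑ i, d (P.2 i))) (fun _ => (1 : ℝ))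
      (fun _ => zero_le_one) hx0.le
    simp only [one_mul] at hw
    rw [← hf] at hw
    refine hw.trans ?_
    have hoth := hsum_others hax hxc (fun _ => (1 : ℝ)) 1 zero_le_one (fun _ _ => le_rfl)
    simp only [one_mul, mul_one] at hoth
    have hF0 : ∀ q' : Equiv.Perm (Fin m) × (Fin m → Fin K),
        0 ≤ |(termSign ε q' : ℝ)| * b ^ (-(∑ i, v (q'.1 i) i (q'.2 i))) * x ^ (∑ i, d (q'.2 i)) :=
      fun q' => mul_nonneg (mul_nonneg (abs_nonneg _) (zpow_pos hb0 _).le) (pow_nonneg hx0.le _)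
    refine (sum_le_vertex_add_others _ hF0 hne P Q hPQ _ ?_).trans ?_
    · intro hmem; rw [Finset.mem_filter] at hmem; exact (Finset.mem_erase.mp hmem.2).1 rfl
    · rw [abs_termSign_eq_one ε hε Q hQ, one_mul]
      simp only [hT] at hoth ⊢
      linarith
  -- the competitor upper bounds at `p` and `q` (margin form, weight `|s − D₁| ≤ Dmax`)
  have hcompM : ∀ {x : ℝ}, a ≤ x → x ≤ c →
      ∑ s ∈ (f.support.erase D₁).erase D₂, |(s : ℝ) - D₁| * |f.coeff s| * x ^ s
        ≤ (N : ℝ) * (Dmax : ℝ) * η * (T p₁ x + T p₂ x) := by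
    intro x hax hxc
    have hx0 : 0 < x := lt_of_lt_of_le ha0 hax
    have hw := weighted_mass_le_sum_terms b hb0 d v ε ((f.support.erase D₁).erase D₂) (fun s => |(s : ℝ) - D₁|)
      (fun _ => abs_nonneg _) hx0.le
    rw [← hf] at hw
    refine hw.trans ?_
    have hφΦ : ∀ q' : Equiv.Perm (Fin m) × (Fin m → Fin K), termSign ε q' ≠ 0 → |((∑ i, d (q'.2 i) : ℕ) : ℝ) - D₁| ≤ (Dmax : ℝ) := by
      intro q' hq'
      have h1 : ((∑ i, d (q'.2 i) : ℕ) : ℝ) ≤ Dmax := by exact_mod_cast hDmax q' hq'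
      have h2 : ((D₁ : ℕ) : ℝ) ≤ Dmax := by exact_mod_cast (le_of_lt hD12).trans hD2le
      have h3 : (0 : ℝ) ≤ ((∑ i, d (q'.2 i) : ℕ) : ℝ) := Nat.cast_nonneg _
      have h4 : (0 : ℝ) ≤ ((D₁ : ℕ) : ℝ) := Nat.cast_nonneg _
      rw [abs_sub_le_iff]; constructor <;> linarith
    have hoth := hsum_others hax hxc (fun s => |(s : ℝ) - D₁|) (Dmax : ℝ) (Nat.cast_nonneg _) hφΦ
    refine le_trans (sum_le_others _ (fun q' => ?_) p₁ p₂ _ ?_ ?_) hoth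
    · exact mul_nonneg (mul_nonneg (mul_nonneg (abs_nonneg _) (abs_nonneg _)) (zpow_pos hb0 _).le) (pow_nonneg hx0.le _)
    · intro hmem; rw [Finset.mem_filter] at hmem
      exact (Finset.mem_erase.mp (Finset.mem_of_mem_erase hmem.2)).1 (by rw [hD₁])
    · intro hmem; rw [Finset.mem_filter] at hmem
      exact (Finset.mem_erase.mp hmem.2).1 (by rw [hD₂])
  ------------------------------------------------------------------ (D) and (M) at `p` and `q`
  have hT1p : 0 < T p₁ p := by simp only [hT]; exact mul_pos (zpow_pos hb0 _) (pow_pos hp0 _)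
  have hT1q : 0 < T p₁ q := by simp only [hT]; exact mul_pos (zpow_pos hb0 _) (pow_pos hq0 _)
  have hDp : ∑ s ∈ f.support.erase D₁, |f.coeff s| * p ^ s < |f.coeff D₁| * p ^ D₁ := by
    have h1 := hcompD hpa hpc p₁ p₂ (Or.inl ⟨rfl, rfl⟩) hp₂
    have h2 := hvert hpa hpc p₁ (Or.inl rfl)
    rw [← hD₁] at h1 h2
    rw [hpT'] at h1 h2
    have : (N : ℝ) * η * (T p₁ p + 1 / 2 * T p₁ p) ≤ (1 / 8) * T p₁ p := by nlinarith
    linarith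
  have hDq : ∑ s ∈ f.support.erase D₂, |f.coeff s| * q ^ s < |f.coeff D₂| * q ^ D₂ := by
    have h1 := hcompD hqa hqc' p₂ p₁ (Or.inr ⟨rfl, rfl⟩) hp₁
    have h2 := hvert hqa hqc' p₂ (Or.inr rfl)
    rw [← hD₂] at h1 h2
    rw [hqT'] at h1 h2
    have : (N : ℝ) * η * (T p₁ q + 2 * T p₁ q) ≤ (1 / 4) * T p₁ q := by nlinarith
    linarith
  have hw21 : (1 : ℝ) ≤ (D₂ : ℝ) - D₁ := by
    have : D₁ + 1 ≤ D₂ := hD12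
    have : ((D₁ : ℝ) + 1 ≤ D₂) := by exact_mod_cast this
    linarith
  have hMp : ∑ s ∈ (f.support.erase D₁).erase D₂, |(s : ℝ) - D₁| * |f.coeff s| * p ^ s
      < ((D₂ : ℝ) - D₁) * |f.coeff D₂| * p ^ D₂ := by
    have h1 := hcompM hpa hpc
    have h2 := hvert hpa hpc p₂ (Or.inr rfl)
    rw [← hD₂] at h2
    rw [hpT'] at h1 h2
    have hX : 0 ≤ |f.coeff D₂| * p ^ D₂ := mul_nonneg (abs_nonneg _) (pow_nonneg hp0.le _)
    have h3 : |f.coeff D₂| * p ^ D₂ ≤ ((D₂ : ℝ) - D₁) * |f.coeff D₂| * p ^ D₂ := by nlinarith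
    have h4 : (N : ℝ) * (Dmax : ℝ) * η * (T p₁ p + 1 / 2 * T p₁ p) + (N : ℝ) * η * (T p₁ p + 1 / 2 * T p₁ p)
        < 1 / 2 * T p₁ p := by
      have : (N : ℝ) * η * ((Dmax : ℝ) + 1) * (3 / 2) ≤ 1 / 4 := by nlinarith
      nlinarith
    linarith
  have hMq : ∑ s ∈ (f.support.erase D₁).erase D₂, |(s : ℝ) - D₁| * |f.coeff s| * q ^ s
      < ((D₂ : ℝ) - D₁) * |f.coeff D₂| * q ^ D₂ := by
    have h1 := hcompM hqa hqc'
    have h2 := hvert hqa hqc' p₂ (Or.inr rfl)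
    rw [← hD₂] at h2
    rw [hqT'] at h1 h2
    have hX : 0 ≤ |f.coeff D₂| * q ^ D₂ := mul_nonneg (abs_nonneg _) (pow_nonneg hq0.le _)
    have h3 : |f.coeff D₂| * q ^ D₂ ≤ ((D₂ : ℝ) - D₁) * |f.coeff D₂| * q ^ D₂ := by nlinarith
    have h4 : (N : ℝ) * (Dmax : ℝ) * η * (T p₁ q + 2 * T p₁ q) + (N : ℝ) * η * (T p₁ q + 2 * T p₁ q)
        < 2 * T p₁ q := by
      have : (N : ℝ) * η * ((Dmax : ℝ) + 1) * 3 ≤ 1 / 2 := by nlinarith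
      nlinarith
    linarith
  ------------------------------------------------------------------ dominance at the window ends
  have hdomA : ∑ s ∈ f.support.erase D₁, |f.coeff s| * a ^ s < |f.coeff D₁| * a ^ D₁ := by
    have := monomial_dominant_of_margin b hb d v ε hε θ₁ M p₁ hp₁ hmar₁ (by rw [← hNdef]; exact hNle)
    rw [← hf, ← hD₁] at this; exact this
  have hdomC : ∑ s ∈ f.support.erase D₂, |f.coeff s| * c ^ s < |f.coeff D₂| * c ^ D₂ := by
    have := monomial_dominant_of_margin b hb d v ε hε θ₂ M p₂ hp₂ hmar₂ (by rw [← hNdef]; exact hNle)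
    rw [← hf, ← hD₂] at this; exact this
  ------------------------------------------------------------------ zeros lie in `[p, q]`
  have hloc : ∀ t : ℝ, a < t → t < c → f.eval t = 0 → t ∈ Set.Icc p q := by
    intro t hat htc hroot
    have ht0 : 0 < t := ha0.trans hat
    constructor
    · by_contra hlt
      push Not at hlt
      have hdom := sum_mul_pow_lt_of_endpoints (f.support.erase D₁) (fun s => |f.coeff s|) (fun _ => abs_nonneg _) D₁
        ha0 hat.le hlt.le hdomA hDp
      have := mul_eval_pos_of_dominant f ht0 hdom
      rw [hroot, mul_zero] at this; exact lt_irrefl _ this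
    · by_contra hlt
      push Not at hlt
      have hdom := sum_mul_pow_lt_of_endpoints (f.support.erase D₂) (fun s => |f.coeff s|) (fun _ => abs_nonneg _) D₂
        hq0 hlt.le htc.le hDq hdomC
      have := mul_eval_pos_of_dominant f ht0 hdom
      rw [hroot, mul_zero] at this; exact lt_irrefl _ this
  ------------------------------------------------------------------ count
  set R := f.roots.toFinset.filter (fun x => b ^ θ₁ < x ∧ x < b ^ θ₂) with hR
  have hmemR : ∀ t ∈ R, a < t ∧ t < c ∧ f.eval t = 0 := by
    intro t ht
    rw [Finset.mem_filter, Multiset.mem_toFinset, Polynomial.mem_roots hf0, Polynomial.IsRoot.def] at ht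
    exact ⟨ht.2.1, ht.2.2, ht.1⟩
  have hle1 : R.card ≤ 1 := by
    refine Finset.card_le_one.mpr fun t₁ ht₁ t₂ ht₂ => ?_
    obtain ⟨h1a, h1c, h1r⟩ := hmemR t₁ ht₁
    obtain ⟨h2a, h2c, h2r⟩ := hmemR t₂ ht₂
    exact eq_of_isRoot_of_mem_window f hD12 hsupp₂ hp0 hMp hMq (hloc t₁ h1a h1c h1r) (hloc t₂ h2a h2c h2r) h1r h2r
  by_cases halt : termSign ε p₁ * termSign ε p₂ < 0
  · rw [if_pos halt]
    refine le_antisymm hle1 ?_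
    obtain ⟨y, hy, hy0⟩ := exists_root_of_alternating_window f hp0 hpq.le hDp hDq (hiff.mpr halt)
    refine Finset.one_le_card.mpr ⟨y, Finset.mem_filter.mpr ⟨?_, hap.trans hy.1, hy.2.trans hqc⟩⟩
    rw [Multiset.mem_toFinset, Polynomial.mem_roots hf0]
    exact hy0
  · rw [if_neg halt]
    refine Nat.le_zero.mp (Finset.card_eq_zero.mpr (Finset.eq_empty_of_forall_notMem fun t ht => ?_)).le
    obtain ⟨hta, htc, htr⟩ := hmemR t ht
    have hpos : 0 < f.coeff D₁ * f.coeff D₂ := by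
      rcases lt_trichotomy (f.coeff D₁ * f.coeff D₂) 0 with h | h | h
      · exact absurd (hiff.mp h) halt
      · exact absurd h (mul_ne_zero hc₁ hc₂)
      · exact h
    exact eval_ne_zero_of_mem_window_of_pos f hD12 hsupp₂ hp0 hpq.le hDp hMp hMq hpos (hloc t hta htc htr) htr

end Summit.ValiantsHypothesis.ValiantsHypothesis.Theorems.KPlusLogSqLaw.LocalDescartes
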